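import Literature.NumberTheory.NumberFields.SqrtTwoTowerFourNormDyadicResidues
import HarnessLib

/-!
# A unit `η ≢ ±1 (mod 𝔭₁⁶)` at a dyadic prime with `e = f = 1` is NOT a norm from the layer `K_4 = K·ℚ(ζ₆₄)⁺` (sixteen tower coordinates);
# hence a unit of `K_3` whose norm to `K` is `≢ ±1 (mod 𝔭₁⁶)` is not a norm from `K_4` — THE LEVEL-`64` DYADIC LEMMA, field side,
# and the unit hypothesis of the quadratic-step unit door at `k = 3`

Topic `NumberTheory/IwasawaTheory` (namespace = path).  THEOREM-ONLY file (no definition, no named fact, no instance, no `sorry`), written by the prover seat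
`bsd-line-att-p3` g50 (cell `bsd-f1-sign2`, WIDTH-5 attach on route `AlignedTransportAtTwo`, crux C2 stmt-BirchSwinnertonDyer-22298; `--supports`, closes nothing).
FIELD SIDE of this seat's `NumberFields/SqrtTwoTowerFourCoordinates.lean` + `NumberFields/SqrtTwoTowerFourNormDyadicResidues.lean` (the local-global algebra of
the level-`64` lemma), one layer above att-p3 g49's `CyclotomicTwoLayerThreeNonNormUnit.lean` (level `32`).  It answers att-p4 g42's ASK (cell STATUS
2026-08-31T15:17Z): the last input of the `1259` / `14891` customer rows of the QUADRATIC-STEP UNIT DOOR `classicalMuVanishes_two_of_unit_not_mem_norm_layer_succ`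
(`ClassicalMuVanishesQuadraticStepNonNormUnitTwo.lean`) at `k = 3` — «a unit `η ∈ E_{K_3}` with `N_{K_3/K}(η) = −ε⁴`, `ε ≡ 9 (mod 16)` at `𝔭₁`, is not a norm
from `K_4`».

* §1 `dyadicLocalization_package` — for ANY localisation `Rₚ` of a Dedekind `R` at a maximal `𝔭 ≠ 0` with `R/𝔭 = 𝔽₂`, `2 ∈ 𝔭 ∖ 𝔭²`: `2` is a uniformiser
  (digits `2q` / `1 + 2q`, `1 + 2q` units, `2` not a unit, `r ∈ 𝔭ⁿ ⟺ 2ⁿ ∣ r`, `t ≠ 0 ⟹ t = 2ⁿ·unit`).  Used with `Rₚ = (𝓞_K)_𝔭 ⊆ K` realised as Mathlib's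
  `Localization.subalgebra.ofField` (so that the tower files' subring `S ⊆ K` is available) and with `Rₚ = Localization.AtPrime 𝔭`.
* §2 ★★ `unitsIncl_unitsMap_not_mem_map_norm_of_tower4` — `K` a number field, `L/K` Galois containing the four-step tower (each step Galois quadratic,
  `s₁² = 2`, …, `s₄² = 2 + s₃`, `s_i` outside the previous field), `𝔭₁` maximal with `𝓞_K/𝔭₁ = 𝔽₂`, `2 ∈ 𝔭₁ ∖ 𝔭₁²`, `η ∈ 𝓞_Kˣ`, `η ∓ 1 ∉ 𝔭₁⁶` ⟹
  **`η ∉ N_{L/K} Lˣ`** (tree currency `unitsIncl K L η ∉ (⊤ : Subgroup Lˣ).map (Herbrand.norm Gal(L/K))`): clear denominators, `N(tz) = t¹⁶η`, and the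
  level-`64` lemma `SqrtTwoTowerFour.norm_ne_pow_mul_of_not_congr` in `S = (𝓞_K)_{𝔭₁}`.
* §3 ★ `exists_generators_four_layers` (`s₁,…,s₄` in the layers `K_1 ⊂ … ⊂ K_4` of a cyclotomic `ℤ₂`-extension of an odd-degree `K` with `2 ∤ d_K`; the new
  step `s₄` by CONJUGATING a root `ψ ∈ K_4` of `Ψ₄`: `ψ² − 2` and `s₃` are roots of the irreducible `Ψ₃`, so `g(ψ² − 2) = s₃` for some `g ∈ Gal(K_4/K)` —
  Mathlib `Normal.minpoly_eq_iff_mem_orbit` — and `s₄ := gψ`); ★★ `unitsIncl_unitsMap_not_mem_map_norm_layer_four` — the κ.layer-`4` form of §2.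
* §4 ★ `pow_four_sub_one_not_mem_pow_six` — `t = 3` (`ε ≡ ±1 (mod 𝔭³)`, `≢ (mod 𝔭⁴)`) ⟹ `ε⁴ ∓ 1 ∉ 𝔭⁶` («`σ₁(ε⁴) ≡ 33 (mod 64)`»);
  ★★ `unitsIncl_layer_three_not_mem_map_norm_layer_four` — **a unit (indeed any element) `η` of `K_3` with `N_{K_3/K}(η) = x ∈ 𝓞_Kˣ`, `x ∓ 1 ∉ 𝔭₁⁶`, is not in
  `N_{K_4/K_3} K_4ˣ`** — literally the hypothesis `hnot` of the door at `k = 3` (stated with `κ.layer (3 + 1)` and the door's algebra structure):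
  transitivity `N_{K_4/K} = N_{K_3/K} ∘ N_{K_4/K_3}` + §3.

«`η ∉ N_{K_4/K}K_4ˣ` locally at `𝔭₁`» is `σ₁(η) ∉ ±1 + 64ℤ₂ = N(ℤ₂[ζ₆₄ + ζ₆₄⁻¹]ˣ)` (local class field theory); only the elementary direction is proved and used.
HONEST SCOPE: elementary (quadratic norms, transitivity, localisation, the tower files) plus the tree's layer package; nothing specific to any summit; no class group
is computed and no certificate for any field is asserted; BSD is not advanced by this file.

References: [NeukirchANT1999] Ch. I §2 (norm; transitivity), Ch. I §11 (localisation), Ch. II §5, Ch. V §1 (norm groups of `ℚ_p(ζ_{pⁿ})`); [Omeara1963] §63A–B;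
[Washington1997] §13.1 (`K_4 = K·ℚ(ζ₆₄)⁺`), §13.3 Prop. 13.22–13.23; [Lang1990] Ch. 13 §4 Lemma 4.1; [Fukuda1994] Thm. 1.
-/

set_option autoImplicit false

noncomputable section

namespace Literature.NumberTheory.IwasawaTheory

open scoped NumberField nonZeroDivisors
open NumberField IsDedekindDomain Field Module
open Literature.NumberTheory.EllipticCurves Literature.NumberTheory.NumberFields Literature.NumberTheory.NumberFields.SqrtTwoTowerFour
  Literature.NumberTheory.GaloisRepresentations Literature.NumberTheory.GaloisRepresentations.Herbrand
  Literature.NumberTheory.GaloisRepresentations.MinkowskiUnit Literature.NumberTheory.GaloisRepresentations.CyclicNormIndex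

/-! ## §1 The dyadic localisation package at a prime with `e = f = 1`, for ANY model `Rₚ` of `(𝓞_K)_𝔭` -/

section LocalPackage

variable {R : Type*} [CommRing R] [IsDedekindDomain R] (P : Ideal R) [P.IsMaximal]
  (Rₚ : Type*) [CommRing Rₚ] [IsDomain Rₚ] [Algebra R Rₚ] [IsLocalization.AtPrime Rₚ P]

/-- **The dyadic localisation package.**  `R` Dedekind, `𝔭 ≠ 0` maximal with `R/𝔭 = 𝔽₂` and `2 ∈ 𝔭 ∖ 𝔭²` (`e = f = 1`); `Rₚ` any localisation of `R`
at `𝔭`.  Then `2` is a uniformiser of the discrete valuation ring `Rₚ`: every element is `2q` or `1 + 2q`, every `1 + 2q` is a unit, `2` is not a unit,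
`r ∈ 𝔭ⁿ ⟺ 2ⁿ ∣ r` in `Rₚ`, and every `t ≠ 0` is `2ⁿ·v` with `v` a unit.
[cite: NeukirchANT1999, Ch. I §11 Prop. (11.5) (the localisation at a prime of a Dedekind domain is a DVR)] [cite: Omeara1963, §63A] -/
theorem dyadicLocalization_package (hP0 : P ≠ ⊥) (hres : ∀ r : R, r ∈ P ∨ r - 1 ∈ P)
    (h2P : (2 : R) ∈ P) (h2P' : (2 : R) ∉ P ^ 2) :
    (∀ r : Rₚ, ∃ q : Rₚ, r = 2 * q ∨ r = 1 + 2 * q) ∧ (∀ q : Rₚ, IsUnit (1 + 2 * q)) ∧ ¬ IsUnit (2 : Rₚ) ∧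
      (∀ (x : R) (n : ℕ), x ∈ P ^ n ↔ ∃ y : Rₚ, algebraMap R Rₚ x = 2 ^ n * y) ∧
      (∀ t : Rₚ, t ≠ 0 → ∃ (n : ℕ) (v : Rₚ), IsUnit v ∧ t = 2 ^ n * v) := by
  classical
  haveI : IsLocalRing Rₚ := IsLocalization.AtPrime.isLocalRing Rₚ P
  haveI : IsDiscreteValuationRing Rₚ := IsLocalization.AtPrime.isDiscreteValuationRing_of_dedekind_domain R hP0 Rₚ
  obtain ⟨ϖ, hϖ⟩ := IsDiscreteValuationRing.exists_irreducible Rₚ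
  have hmax : IsLocalRing.maximalIdeal Rₚ = Ideal.span {ϖ} := (IsDiscreteValuationRing.irreducible_iff_uniformizer ϖ).mp hϖ
  have hprime : Prime ϖ := by
    rw [← Ideal.span_singleton_prime hϖ.ne_zero, ← hmax]
    exact (IsLocalRing.maximalIdeal.isMaximal _).isPrime
  -- `r ∈ 𝔭ⁿ ⟺ ϖⁿ ∣ r`
  have hmem : ∀ (r : R) (n : ℕ), r ∈ P ^ n ↔ ϖ ^ n ∣ algebraMap R Rₚ r := by
    intro r n
    rw [← IsLocalization.AtPrime.under_maximalIdeal_pow P Rₚ n, Ideal.mem_comap, hmax, Ideal.span_singleton_pow,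
      Ideal.mem_span_singleton]
  -- `2 = ϖ u` with `u` a unit
  obtain ⟨u, hu⟩ : ϖ ^ 1 ∣ algebraMap R Rₚ 2 := (hmem 2 1).mp (by rwa [pow_one])
  rw [pow_one, map_ofNat] at hu
  have hunit : ∀ r : Rₚ, ¬ ϖ ∣ r → IsUnit r := by
    intro r hr
    by_contra hnu
    have hmemr : r ∈ IsLocalRing.maximalIdeal Rₚ := (IsLocalRing.mem_maximalIdeal r).mpr (mem_nonunits_iff.mpr hnu)
    rw [hmax, Ideal.mem_span_singleton] at hmemr
    exact hr hmemr
  have hundvd : ¬ ϖ ∣ u := by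
    rintro ⟨u', rfl⟩
    apply h2P'
    rw [hmem, map_ofNat, hu]
    exact ⟨u', by ring⟩
  obtain ⟨uu, huu⟩ := hunit u hundvd
  have hϖ2 : ϖ = 2 * ↑uu⁻¹ := by rw [hu, ← huu, mul_assoc, Units.mul_inv, mul_one]
  -- residues
  have hresS : ∀ t : Rₚ, ϖ ∣ t ∨ ϖ ∣ t - 1 := by
    intro t
    obtain ⟨⟨r, s⟩, rfl⟩ := IsLocalization.mk'_surjective P.primeCompl t
    have hs : (s : R) ∉ P := s.2
    have hs1 : (s : R) - 1 ∈ P := (hres s).resolve_left hs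
    have hsu : IsUnit (algebraMap R Rₚ s) := IsLocalization.map_units _ s
    have hspec : IsLocalization.mk' Rₚ r s * algebraMap R _ (s : R) = algebraMap R _ r := IsLocalization.mk'_spec _ r s
    rcases hres r with hr | hr
    · left
      have h1 : ϖ ^ 1 ∣ algebraMap R Rₚ r := (hmem r 1).mp (by rwa [pow_one])
      rw [pow_one, ← hspec] at h1
      exact (hsu.dvd_mul_right).mp h1
    · right
      have hrs : r - s ∈ P ^ 1 := by
        rw [pow_one, show r - (s : R) = (r - 1) - ((s : R) - 1) by ring]
        exact P.sub_mem hr hs1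
      have h1 := (hmem _ 1).mp hrs
      rw [pow_one, map_sub, ← hspec, ← sub_one_mul] at h1
      exact (hsu.dvd_mul_right).mp h1
  refine ⟨fun r => ?_, fun q => ?_, ?_, fun x n => ?_, fun t ht => ?_⟩
  · rcases hresS r with ⟨r', hr'⟩ | ⟨r', hr'⟩
    · exact ⟨↑uu⁻¹ * r', Or.inl (by rw [← mul_assoc, ← hϖ2, hr'])⟩
    · exact ⟨↑uu⁻¹ * r', Or.inr (by rw [← mul_assoc, ← hϖ2, ← hr']; ring)⟩
  · apply hunit
    intro hd
    have h1 : ϖ ∣ (1 : Rₚ) := by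
      have := hd.sub (Dvd.dvd.mul_right (show ϖ ∣ (2 : Rₚ) from ⟨u, hu⟩) q)
      simpa using this
    exact hprime.not_unit (isUnit_of_dvd_one h1)
  · rw [hu]
    exact fun h2 => hprime.not_unit (isUnit_of_mul_isUnit_left h2)
  · rw [hmem]
    constructor
    · rintro ⟨c, hc⟩
      exact ⟨(↑uu⁻¹ : Rₚ) ^ n * c, by rw [hc, hϖ2, mul_pow, mul_assoc]⟩
    · rintro ⟨y, hy⟩
      exact ⟨u ^ n * y, by rw [hy, hu, mul_pow, mul_assoc]⟩
  · obtain ⟨n, v, hv⟩ := IsDiscreteValuationRing.associated_pow_irreducible ht hϖ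
    refine ⟨n, ↑(uu⁻¹ ^ n * v⁻¹), Units.isUnit _, ?_⟩
    rw [Units.val_mul, Units.val_pow_eq_pow_val, ← mul_assoc, ← mul_pow, ← hϖ2, ← hv, mul_assoc, Units.mul_inv, mul_one]

end LocalPackage

/-! ## §2 ★★ Number fields: a unit `η ≢ ±1 (mod 𝔭₁⁶)` is not a norm from the four-step tower -/

section NumberField

variable {K K₁ K₂ K₃ L : Type*} [Field K] [NumberField K] [Field K₁] [Field K₂] [Field K₃] [Field L] [NumberField L]
  [Algebra K K₁] [Algebra K₁ K₂] [Algebra K K₂] [IsScalarTower K K₁ K₂]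
  [Algebra K₂ K₃] [Algebra K K₃] [Algebra K₁ K₃] [IsScalarTower K K₂ K₃] [IsScalarTower K₁ K₂ K₃]
  [Algebra K₃ L] [Algebra K L] [IsScalarTower K K₃ L]

set_option maxHeartbeats 1600000 in
/-- ★★ **A unit `η ≢ ±1 (mod 𝔭₁⁶)` is not a norm from the four-step tower (THE LEVEL-`64` DYADIC LEMMA, number-field form).**  `K` a number field,
`L/K` Galois containing `K ⊂ K₁ ⊂ K₂ ⊂ K₃ ⊂ L` with `[K₁:K] = [K₂:K₁] = [K₃:K₂] = [L:K₃] = 2` (each Galois), `s₁² = 2`, `s₂² = 2 + s₁`, `s₃² = 2 + s₂`,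
`s₄² = 2 + s₃`, `s_i` outside the previous field (a model of `K_4 = K·ℚ(ζ₆₄)⁺`); `𝔭₁` a maximal ideal of `𝓞_K` with `𝓞_K/𝔭₁ = 𝔽₂` and `2 ∈ 𝔭₁ ∖ 𝔭₁²`;
`η ∈ 𝓞_Kˣ` with `η − 1 ∉ 𝔭₁⁶` and `η + 1 ∉ 𝔭₁⁶`.  THEN `η ∉ N_{L/K} Lˣ` (tree currency `unitsIncl K L η ∉ (⊤ : Subgroup Lˣ).map (Herbrand.norm Gal(L/K))`):
a `z` with `N(z) = η` has sixteen tower coordinates `c/t`, `c ∈ 𝓞_K`; `N(tz) = t¹⁶η`; in `S = (𝓞_K)_{𝔭₁} ⊆ K` (`2`-adically digitised, `t = 2ⁿ v`) the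
level-`64` lemma `SqrtTwoTowerFour.norm_ne_pow_mul_of_not_congr` forbids it.  («`σ₁(η) ∉ ±1 + 64ℤ₂ = N(ℤ₂[ζ₆₄+ζ₆₄⁻¹]ˣ)`», local class field theory; only
this elementary direction is proved and used.) [cite: NeukirchANT1999, Ch. V §1 (norm group of `ℚ₂(ζ_{2ⁿ})`: `(2) × U^{(n)}`)] [cite: Omeara1963, §63B]
[cite: Washington1997, §13.1 (`K_4 = K·ℚ(ζ₆₄)⁺`)] -/
theorem unitsIncl_unitsMap_not_mem_map_norm_of_tower4 [IsGalois K L]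
    [FiniteDimensional K K₁] [IsGalois K K₁] [FiniteDimensional K₁ K₂] [IsGalois K₁ K₂] [FiniteDimensional K₂ K₃] [IsGalois K₂ K₃]
    [FiniteDimensional K₃ L] [IsGalois K₃ L]
    (h1 : Module.finrank K K₁ = 2) (h2 : Module.finrank K₁ K₂ = 2) (h3 : Module.finrank K₂ K₃ = 2) (h4 : Module.finrank K₃ L = 2)
    {s₁ : K₁} (hs₁ : s₁ ^ 2 = 2) (hs₁K : ∀ k : K, algebraMap K K₁ k ≠ s₁)
    {s₂ : K₂} (hs₂ : s₂ ^ 2 = algebraMap K₁ K₂ (2 + s₁)) (hs₂K : ∀ x : K₁, algebraMap K₁ K₂ x ≠ s₂)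
    {s₃ : K₃} (hs₃ : s₃ ^ 2 = algebraMap K₂ K₃ (2 + s₂)) (hs₃K : ∀ x : K₂, algebraMap K₂ K₃ x ≠ s₃)
    {s₄ : L} (hs₄ : s₄ ^ 2 = algebraMap K₃ L (2 + s₃)) (hs₄K : ∀ x : K₃, algebraMap K₃ L x ≠ s₄)
    (P : Ideal (𝓞 K)) [P.IsMaximal] (hP0 : P ≠ ⊥) (hres : ∀ r : 𝓞 K, r ∈ P ∨ r - 1 ∈ P)
    (h2P : (2 : 𝓞 K) ∈ P) (h2P' : (2 : 𝓞 K) ∉ P ^ 2) (η : (𝓞 K)ˣ) (hη1 : (η : 𝓞 K) - 1 ∉ P ^ 6) (hη2 : (η : 𝓞 K) + 1 ∉ P ^ 6) :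
    unitsIncl K L (Units.map (algebraMap (𝓞 K) K : 𝓞 K →* K) η) ∉
      (⊤ : Subgroup Lˣ).map (Herbrand.norm (L ≃ₐ[K] L)) := by
  classical
  rintro ⟨zu, -, hzu⟩
  -- `N_{L/K}(z) = η`
  have hnorm : algebraMap K L (Algebra.norm K (zu : L)) = algebraMap K L (algebraMap (𝓞 K) K η) := by
    rw [Algebra.norm_eq_prod_automorphisms]
    have := congrArg (fun x : Lˣ => (x : L)) hzu
    simp only [Herbrand.norm_apply, Units.coe_prod, val_smul, Units.coe_map, MonoidHom.coe_coe] at this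
    exact this
  have hnormK : Algebra.norm K (zu : L) = algebraMap (𝓞 K) K η := (algebraMap K L).injective hnorm
  -- sixteen coordinates and a common denominator
  obtain ⟨Pz, Qz, hz⟩ := exists_eq_add_mul_of_finrank_eq_two h4 hs₄K (zu : L)
  obtain ⟨x₀, x₁, x₂, x₃, x₄, x₅, x₆, x₇, hPz⟩ := exists_coord8_of_tower h1 h2 h3 hs₁K hs₂K hs₃K Pz
  obtain ⟨y₀, y₁, y₂, y₃, y₄, y₅, y₆, y₇, hQz⟩ := exists_coord8_of_tower h1 h2 h3 hs₁K hs₂K hs₃K Qz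
  obtain ⟨b, hint⟩ := IsLocalization.exist_integer_multiples_of_finset (nonZeroDivisors (𝓞 K))
    ({x₀, x₁, x₂, x₃, x₄, x₅, x₆, x₇, y₀, y₁, y₂, y₃, y₄, y₅, y₆, y₇} : Finset K)
  set t : 𝓞 K := (b : 𝓞 K) with htdef
  have ht0 : t ≠ 0 := nonZeroDivisors.coe_ne_zero b
  have hget : ∀ x : K, x ∈ ({x₀, x₁, x₂, x₃, x₄, x₅, x₆, x₇, y₀, y₁, y₂, y₃, y₄, y₅, y₆, y₇} : Finset K) →
      ∃ c : 𝓞 K, algebraMap (𝓞 K) K c = algebraMap (𝓞 K) K t * x := by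
    intro x hx
    obtain ⟨c, hc⟩ := hint x hx
    exact ⟨c, by rw [hc, Algebra.smul_def]⟩
  obtain ⟨c₀, hc₀⟩ := hget x₀ (by simp)
  obtain ⟨c₁, hc₁⟩ := hget x₁ (by simp)
  obtain ⟨c₂, hc₂⟩ := hget x₂ (by simp)
  obtain ⟨c₃, hc₃⟩ := hget x₃ (by simp)
  obtain ⟨c₄, hc₄⟩ := hget x₄ (by simp)
  obtain ⟨c₅, hc₅⟩ := hget x₅ (by simp)
  obtain ⟨c₆, hc₆⟩ := hget x₆ (by simp)
  obtain ⟨c₇, hc₇⟩ := hget x₇ (by simp)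
  obtain ⟨d₀, hd₀⟩ := hget y₀ (by simp)
  obtain ⟨d₁, hd₁⟩ := hget y₁ (by simp)
  obtain ⟨d₂, hd₂⟩ := hget y₂ (by simp)
  obtain ⟨d₃, hd₃⟩ := hget y₃ (by simp)
  obtain ⟨d₄, hd₄⟩ := hget y₄ (by simp)
  obtain ⟨d₅, hd₅⟩ := hget y₅ (by simp)
  obtain ⟨d₆, hd₆⟩ := hget y₆ (by simp)
  obtain ⟨d₇, hd₇⟩ := hget y₇ (by simp)
  -- the local ring `S = (𝓞 K)_𝔭₁ ⊆ K`
  set Sₚ : Subalgebra (𝓞 K) K := Localization.subalgebra.ofField K P.primeCompl P.primeCompl_le_nonZeroDivisors with hSₚ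
  obtain ⟨hdig, hloc, h2S, hmem, hfac⟩ := dyadicLocalization_package P Sₚ hP0 hres h2P h2P'
  set S : Subring K := Sₚ.toSubring with hSdef
  have hmemS : ∀ c : 𝓞 K, algebraMap (𝓞 K) K c ∈ S := fun c => Sₚ.algebraMap_mem c
  -- coordinates in `S`
  let a : Fin 8 → S := ![⟨_, hmemS c₀⟩, ⟨_, hmemS c₁⟩, ⟨_, hmemS c₂⟩, ⟨_, hmemS c₃⟩, ⟨_, hmemS c₄⟩, ⟨_, hmemS c₅⟩, ⟨_, hmemS c₆⟩, ⟨_, hmemS c₇⟩]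
  let b' : Fin 8 → S := ![⟨_, hmemS d₀⟩, ⟨_, hmemS d₁⟩, ⟨_, hmemS d₂⟩, ⟨_, hmemS d₃⟩, ⟨_, hmemS d₄⟩, ⟨_, hmemS d₅⟩, ⟨_, hmemS d₆⟩, ⟨_, hmemS d₇⟩]
  have hfin : Module.finrank K L = 16 := finrank_eq_sixteen h1 h2 h3 h4
  -- `t z` in coordinates
  have htz : algebraMap K L (algebraMap (𝓞 K) K t) * (zu : L) =
      algebraMap K₃ L (algebraMap K K₃ (a 0 : K) + algebraMap K K₃ (a 1 : K) * algebraMap K₁ K₃ s₁ +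
        (algebraMap K K₃ (a 2 : K) + algebraMap K K₃ (a 3 : K) * algebraMap K₁ K₃ s₁) * algebraMap K₂ K₃ s₂ +
        (algebraMap K K₃ (a 4 : K) + algebraMap K K₃ (a 5 : K) * algebraMap K₁ K₃ s₁ +
          (algebraMap K K₃ (a 6 : K) + algebraMap K K₃ (a 7 : K) * algebraMap K₁ K₃ s₁) * algebraMap K₂ K₃ s₂) * s₃) +
      algebraMap K₃ L (algebraMap K K₃ (b' 0 : K) + algebraMap K K₃ (b' 1 : K) * algebraMap K₁ K₃ s₁ +
        (algebraMap K K₃ (b' 2 : K) + algebraMap K K₃ (b' 3 : K) * algebraMap K₁ K₃ s₁) * algebraMap K₂ K₃ s₂ +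
        (algebraMap K K₃ (b' 4 : K) + algebraMap K K₃ (b' 5 : K) * algebraMap K₁ K₃ s₁ +
          (algebraMap K K₃ (b' 6 : K) + algebraMap K K₃ (b' 7 : K) * algebraMap K₁ K₃ s₁) * algebraMap K₂ K₃ s₂) * s₃) * s₄ := by
    have e : ∀ i, (a i : K) = ![algebraMap (𝓞 K) K c₀, algebraMap (𝓞 K) K c₁, algebraMap (𝓞 K) K c₂, algebraMap (𝓞 K) K c₃,
        algebraMap (𝓞 K) K c₄, algebraMap (𝓞 K) K c₅, algebraMap (𝓞 K) K c₆, algebraMap (𝓞 K) K c₇] i := by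
      intro i; fin_cases i <;> rfl
    have e' : ∀ i, (b' i : K) = ![algebraMap (𝓞 K) K d₀, algebraMap (𝓞 K) K d₁, algebraMap (𝓞 K) K d₂, algebraMap (𝓞 K) K d₃,
        algebraMap (𝓞 K) K d₄, algebraMap (𝓞 K) K d₅, algebraMap (𝓞 K) K d₆, algebraMap (𝓞 K) K d₇] i := by
      intro i; fin_cases i <;> rfl
    simp only [e, e', Matrix.cons_val_zero, Matrix.cons_val_one, Matrix.cons_val]
    rw [hz, hPz, hQz, hc₀, hc₁, hc₂, hc₃, hc₄, hc₅, hc₆, hc₇, hd₀, hd₁, hd₂, hd₃, hd₄, hd₅, hd₆, hd₇]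
    simp only [map_add, map_mul, ← IsScalarTower.algebraMap_apply K K₃ L]
    ring
  -- `N(t z) = t¹⁶ η`
  have hnorm' : Algebra.norm K (algebraMap K L (algebraMap (𝓞 K) K t) * (zu : L)) =
      (algebraMap (𝓞 K) K t) ^ 16 * algebraMap (𝓞 K) K η := by
    rw [map_mul, Algebra.norm_algebraMap, hfin, hnormK]
  rw [htz] at hnorm'
  -- `t = 2ⁿ v` and `η` in `S`
  let tS : S := ⟨algebraMap (𝓞 K) K t, hmemS t⟩
  let ηS : S := ⟨algebraMap (𝓞 K) K (η : 𝓞 K), hmemS η⟩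
  have htS0 : (tS : Sₚ) ≠ 0 := by
    intro h0
    apply ht0
    have : algebraMap (𝓞 K) K t = 0 := congrArg Subtype.val h0
    exact (map_eq_zero_iff _ (IsFractionRing.injective (𝓞 K) K)).mp this
  obtain ⟨n, v, hv, htv⟩ := hfac tS htS0
  have hηS : IsUnit (ηS : Sₚ) := by
    have : (ηS : Sₚ) = algebraMap (𝓞 K) Sₚ (η : 𝓞 K) := rfl
    rw [this]
    exact (Units.map (algebraMap (𝓞 K) Sₚ : 𝓞 K →* Sₚ) η).isUnit
  have hη1S : ∀ q : Sₚ, (ηS : Sₚ) ≠ 1 + 64 * q := by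
    intro q hq
    apply hη1
    rw [hmem]
    refine ⟨q, ?_⟩
    rw [map_sub, map_one, show algebraMap (𝓞 K) Sₚ (η : 𝓞 K) = ηS from rfl, hq]
    ring
  have hη2S : ∀ q : Sₚ, (ηS : Sₚ) ≠ -1 + 64 * q := by
    intro q hq
    apply hη2
    rw [hmem]
    refine ⟨q, ?_⟩
    rw [map_add, map_one, show algebraMap (𝓞 K) Sₚ (η : 𝓞 K) = ηS from rfl, hq]
    ring
  refine norm_ne_pow_mul_of_not_congr S h1 h2 h3 h4 hs₁ hs₂ hs₃ hs₁K hs₂K hs₃K hs₄ hs₄K hdig hloc h2S hηS hv hη1S hη2S n a b' ?_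
  rw [hnorm']
  have htvK : algebraMap (𝓞 K) K t = 2 ^ n * (v : K) := by
    change (tS : K) = 2 ^ n * (v : K)
    have := congrArg Subtype.val htv
    push_cast at this
    exact this
  rw [htvK]
  push_cast
  ring

end NumberField

/-! ## §3 ★★ The layers `K_1 ⊂ K_2 ⊂ K_3 ⊂ K_4` of a cyclotomic `ℤ₂`-extension of an odd-degree `K` -/

section Layers

variable {K : Type} [Field K] [NumberField K]

/-- ★ **Generators of four layers.**  `2 ∤ [K:ℚ]`, `2 ∤ d_K`, `κ` cyclotomic: there are `s₁ ∈ K_1`, `s₂ ∈ K_2`, `s₃ ∈ K_3`, `s₄ ∈ K_4` with `s₁² = 2`,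
`s₂² = 2 + s₁`, `s₃² = 2 + s₂`, `s₄² = 2 + s₃`, each outside the previous layer.  From att-p4 g41's three layers (`exists_generators_three_layers`) and a root
`ψ ∈ K_4` of `Ψ₄` (tree `exists_iterate_root_layer_of_not_dvd_finrank`): `ψ² − 2` and `s₃` are roots of `Ψ₃`, irreducible over the odd-degree `K`
(`NestedSqrtTwo.minpoly_eq_of_odd_finrank`), hence conjugate under `Gal(K_4/K)` (Mathlib `Normal.minpoly_eq_iff_mem_orbit`): `s₄ := g ψ` with `g(ψ² − 2) = s₃`.
`s₄ ∉ K_3` because `[K(s₄):K] = 16 > 8`. [cite: Washington1997, §13.1 (`K_n = K·ℚ(ζ_{2^{n+2}})⁺`, `[K_n : K] = 2ⁿ`)] -/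
theorem exists_generators_four_layers (hK : ¬ 2 ∣ Module.finrank ℚ K) (hd : ¬ (2 : ℤ) ∣ NumberField.discr K)
    (κ : ZpExtension K 2) (hκ : κ.IsCyclotomic)
    [Algebra (κ.layer 1) (κ.layer 2)] [IsScalarTower K (κ.layer 1) (κ.layer 2)] [Algebra (κ.layer 2) (κ.layer 3)] [IsScalarTower K (κ.layer 2) (κ.layer 3)]
    [Algebra (κ.layer 3) (κ.layer 4)] [IsScalarTower K (κ.layer 3) (κ.layer 4)] :
    ∃ (s₁ : κ.layer 1) (s₂ : κ.layer 2) (s₃ : κ.layer 3) (s₄ : κ.layer 4), s₁ ^ 2 = 2 ∧ s₂ ^ 2 = algebraMap (κ.layer 1) (κ.layer 2) (2 + s₁) ∧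
      s₃ ^ 2 = algebraMap (κ.layer 2) (κ.layer 3) (2 + s₂) ∧ s₄ ^ 2 = algebraMap (κ.layer 3) (κ.layer 4) (2 + s₃) ∧
      (∀ x : K, algebraMap K (κ.layer 1) x ≠ s₁) ∧ (∀ x : κ.layer 1, algebraMap (κ.layer 1) (κ.layer 2) x ≠ s₂) ∧
      (∀ x : κ.layer 2, algebraMap (κ.layer 2) (κ.layer 3) x ≠ s₃) ∧ (∀ x : κ.layer 3, algebraMap (κ.layer 3) (κ.layer 4) x ≠ s₄) := by
  haveI : Fact (Nat.Prime 2) := ⟨Nat.prime_two⟩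
  haveI : FiniteDimensional K (κ.layer 3) := κ.finiteDimensional_layer_holds 3
  haveI : FiniteDimensional K (κ.layer 4) := κ.finiteDimensional_layer_holds 4
  haveI : IsGalois K (κ.layer 4) := κ.isGalois_layer_holds 4
  have hodd : Odd (Module.finrank ℚ K) := Nat.odd_iff.mpr (Nat.two_dvd_ne_zero.mp hK)
  obtain ⟨s₁, s₂, s₃, hs₁, hs₂, hs₃, hs₁K, hs₂K, hs₃K⟩ := exists_generators_three_layers hK hd κ hκ
  obtain ⟨ψ, hψ⟩ := exists_iterate_root_layer_of_not_dvd_finrank hK κ hκ 4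
  -- `θ' = ψ² − 2` and `s₃' = ι s₃` are roots of `Ψ₃`
  have hθ : (fun x : κ.layer 4 => x ^ 2 - 2)^[3] (ψ ^ 2 - 2) = 0 := by
    rw [Function.iterate_succ_apply] at hψ
    exact hψ
  have hs₃' : (fun x : κ.layer 4 => x ^ 2 - 2)^[3] (algebraMap (κ.layer 3) (κ.layer 4) s₃) = 0 := by
    have e1 : (algebraMap (κ.layer 3) (κ.layer 4) s₃) ^ 2 - 2 =
        algebraMap (κ.layer 3) (κ.layer 4) (algebraMap (κ.layer 2) (κ.layer 3) s₂) := by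
      rw [← map_pow, hs₃, map_add, map_add, map_ofNat, map_ofNat, add_sub_cancel_left]
    have e2 : (algebraMap (κ.layer 3) (κ.layer 4) (algebraMap (κ.layer 2) (κ.layer 3) s₂)) ^ 2 - 2 =
        algebraMap (κ.layer 3) (κ.layer 4) (algebraMap (κ.layer 2) (κ.layer 3) (algebraMap (κ.layer 1) (κ.layer 2) s₁)) := by
      rw [← map_pow, ← map_pow, hs₂, map_add, map_add, map_add, map_ofNat, map_ofNat, map_ofNat, add_sub_cancel_left]
    have e3 : (algebraMap (κ.layer 3) (κ.layer 4) (algebraMap (κ.layer 2) (κ.layer 3) (algebraMap (κ.layer 1) (κ.layer 2) s₁))) ^ 2 - 2 = 0 := by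
      rw [← map_pow, ← map_pow, ← map_pow, hs₁, map_ofNat, map_ofNat, map_ofNat, sub_self]
    show (((algebraMap (κ.layer 3) (κ.layer 4) s₃) ^ 2 - 2) ^ 2 - 2) ^ 2 - 2 = 0
    rw [e1, e2, e3]
  -- they are conjugate
  have hmin : minpoly K (algebraMap (κ.layer 3) (κ.layer 4) s₃) = minpoly K (ψ ^ 2 - 2) := by
    rw [NestedSqrtTwo.minpoly_eq_of_odd_finrank hodd _ hs₃', NestedSqrtTwo.minpoly_eq_of_odd_finrank hodd (ψ ^ 2 - 2) hθ]
  obtain ⟨g, hg⟩ := MulAction.mem_orbit_iff.mp ((Normal.minpoly_eq_iff_mem_orbit (E := κ.layer 4)).mp hmin)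
  rw [AlgEquiv.smul_def] at hg
  refine ⟨s₁, s₂, s₃, g ψ, hs₁, hs₂, hs₃, ?_, hs₁K, hs₂K, hs₃K, ?_⟩
  · rw [map_add, map_ofNat, ← hg, ← map_pow, map_sub, map_ofNat]; ring
  · -- `g ψ ∉ K_3`: it is a root of `Ψ₄`, of degree `16 > [K_3 : K] = 8` over `K`
    rintro a ha
    have ha4 : (fun x : κ.layer 3 => x ^ 2 - 2)^[4] a = 0 := by
      apply (algebraMap (κ.layer 3) (κ.layer 4)).injective
      have h := NestedSqrtTwo.map_iterate (algebraMap (κ.layer 3) (κ.layer 4)) a 4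
      have hg4 : (fun x : κ.layer 4 => x ^ 2 - 2)^[4] (g ψ) = 0 := by
        have h' := NestedSqrtTwo.map_iterate (g : κ.layer 4 →+* κ.layer 4) ψ 4
        rw [hψ, map_zero] at h'
        simpa using h'.symm
      rw [h, ha, hg4, map_zero]
    have h16 := NestedSqrtTwo.finrank_adjoin_eq_of_odd_finrank hodd a ha4
    have htower := Module.finrank_mul_finrank K (IntermediateField.adjoin K ({a} : Set (κ.layer 3))) (κ.layer 3)
    rw [h16, κ.finrank_layer_holds 3] at htower
    omega

/-- ★★ **THE LEVEL-`64` DYADIC LEMMA for the layer `K_4` of a cyclotomic `ℤ₂`-extension.**  `K` of odd degree with `2 ∤ d_K`, `κ` cyclotomic,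
`𝔭₁ ∤` … a maximal ideal of `𝓞_K` with `𝓞_K/𝔭₁ = 𝔽₂` and `2 ∈ 𝔭₁ ∖ 𝔭₁²`; `η ∈ 𝓞_Kˣ` with `η ∓ 1 ∉ 𝔭₁⁶`.  Then `η ∉ N_{K_4/K} K_4ˣ`.
[cite: Washington1997, §13.1 (`K_4 = K·ℚ(ζ₆₄)⁺`)] [cite: NeukirchANT1999, Ch. V §1 (norm group of `ℚ₂(ζ₆₄)`)] [cite: Omeara1963, §63B] -/
theorem unitsIncl_unitsMap_not_mem_map_norm_layer_four (hK : ¬ 2 ∣ Module.finrank ℚ K) (hd : ¬ (2 : ℤ) ∣ NumberField.discr K)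
    (κ : ZpExtension K 2) (hκ : κ.IsCyclotomic) [NumberField (κ.layer 4)]
    (P : Ideal (𝓞 K)) [P.IsMaximal] (hP0 : P ≠ ⊥) (hres : ∀ r : 𝓞 K, r ∈ P ∨ r - 1 ∈ P)
    (h2 : (2 : 𝓞 K) ∈ P) (h2' : (2 : 𝓞 K) ∉ P ^ 2) (η : (𝓞 K)ˣ) (hη1 : (η : 𝓞 K) - 1 ∉ P ^ 6) (hη2 : (η : 𝓞 K) + 1 ∉ P ^ 6) :
    unitsIncl K (κ.layer 4) (Units.map (algebraMap (𝓞 K) K : 𝓞 K →* K) η) ∉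
      (⊤ : Subgroup (κ.layer 4)ˣ).map (Herbrand.norm ((κ.layer 4) ≃ₐ[K] (κ.layer 4))) := by
  classical
  haveI : Fact (Nat.Prime 2) := ⟨Nat.prime_two⟩
  have h12 : κ.layer 1 ≤ κ.layer 2 := κ.layer_mono one_le_two
  have h23 : κ.layer 2 ≤ κ.layer 3 := κ.layer_mono (by norm_num)
  have h34 : κ.layer 3 ≤ κ.layer 4 := κ.layer_mono (by norm_num)
  have h13 : κ.layer 1 ≤ κ.layer 3 := h12.trans h23
  letI alg12 : Algebra (κ.layer 1) (κ.layer 2) := (IntermediateField.inclusion h12).toRingHom.toAlgebra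
  letI alg23 : Algebra (κ.layer 2) (κ.layer 3) := (IntermediateField.inclusion h23).toRingHom.toAlgebra
  letI alg13 : Algebra (κ.layer 1) (κ.layer 3) := (IntermediateField.inclusion h13).toRingHom.toAlgebra
  letI alg34 : Algebra (κ.layer 3) (κ.layer 4) := (IntermediateField.inclusion h34).toRingHom.toAlgebra
  haveI tow12 : IsScalarTower K (κ.layer 1) (κ.layer 2) :=
    IsScalarTower.of_algebraMap_eq fun x => ((IntermediateField.inclusion h12).commutes x).symm
  haveI tow23 : IsScalarTower K (κ.layer 2) (κ.layer 3) :=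
    IsScalarTower.of_algebraMap_eq fun x => ((IntermediateField.inclusion h23).commutes x).symm
  haveI tow13 : IsScalarTower K (κ.layer 1) (κ.layer 3) :=
    IsScalarTower.of_algebraMap_eq fun x => ((IntermediateField.inclusion h13).commutes x).symm
  haveI tow34 : IsScalarTower K (κ.layer 3) (κ.layer 4) :=
    IsScalarTower.of_algebraMap_eq fun x => ((IntermediateField.inclusion h34).commutes x).symm
  haveI tow123 : IsScalarTower (κ.layer 1) (κ.layer 2) (κ.layer 3) :=
    IsScalarTower.of_algebraMap_eq fun x => (IntermediateField.inclusion_inclusion h12 h23 x).symm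
  haveI : FiniteDimensional K (κ.layer 1) := κ.finiteDimensional_layer_holds 1
  haveI : FiniteDimensional K (κ.layer 2) := κ.finiteDimensional_layer_holds 2
  haveI : FiniteDimensional K (κ.layer 3) := κ.finiteDimensional_layer_holds 3
  haveI : FiniteDimensional K (κ.layer 4) := κ.finiteDimensional_layer_holds 4
  haveI : IsGalois K (κ.layer 1) := κ.isGalois_layer_holds 1
  haveI : IsGalois K (κ.layer 2) := κ.isGalois_layer_holds 2
  haveI : IsGalois K (κ.layer 3) := κ.isGalois_layer_holds 3
  haveI : IsGalois K (κ.layer 4) := κ.isGalois_layer_holds 4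
  haveI : IsGalois (κ.layer 1) (κ.layer 2) := IsGalois.tower_top_of_isGalois K _ _
  haveI : IsGalois (κ.layer 2) (κ.layer 3) := IsGalois.tower_top_of_isGalois K _ _
  haveI : IsGalois (κ.layer 3) (κ.layer 4) := IsGalois.tower_top_of_isGalois K _ _
  haveI : FiniteDimensional (κ.layer 1) (κ.layer 2) := Module.Finite.of_restrictScalars_finite K _ _
  haveI : FiniteDimensional (κ.layer 2) (κ.layer 3) := Module.Finite.of_restrictScalars_finite K _ _
  haveI : FiniteDimensional (κ.layer 3) (κ.layer 4) := Module.Finite.of_restrictScalars_finite K _ _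
  have hdeg1 : Module.finrank K (κ.layer 1) = 2 := by rw [κ.finrank_layer_holds 1, pow_one]
  have hdeg2 : Module.finrank (κ.layer 1) (κ.layer 2) = 2 := by
    rw [finrank_layer_layer κ one_le_two]; norm_num
  have hdeg3 : Module.finrank (κ.layer 2) (κ.layer 3) = 2 := by
    rw [finrank_layer_layer κ (show 2 ≤ 3 by norm_num)]; norm_num
  have hdeg4 : Module.finrank (κ.layer 3) (κ.layer 4) = 2 := by
    rw [finrank_layer_layer κ (show 3 ≤ 4 by norm_num)]; norm_num
  obtain ⟨s₁, s₂, s₃, s₄, hs₁, hs₂, hs₃, hs₄, hs₁K, hs₂K, hs₃K, hs₄K⟩ := exists_generators_four_layers hK hd κ hκ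
  exact unitsIncl_unitsMap_not_mem_map_norm_of_tower4 hdeg1 hdeg2 hdeg3 hdeg4 hs₁ hs₁K hs₂ hs₂K hs₃ hs₃K hs₄ hs₄K
    P hP0 hres h2 h2' η hη1 hη2

end Layers

/-! ## §4 ★★ The unit hypothesis of the quadratic-step door at `k = 3`: a unit of `K_3` whose norm to `K` is `≢ ±1 (mod 𝔭₁⁶)` is not a norm from `K_4` -/

section Residue

variable {R : Type*} [CommRing R] [IsDedekindDomain R] (P : Ideal R) [P.IsMaximal]

/-- ★ **`t = 3` ⟹ `ε⁴ ≢ ±1 (mod 𝔭⁶)`**: `ε ≡ ±1 (mod 𝔭³)`, `ε ≢ ±1 (mod 𝔭⁴)` at a maximal `𝔭` with `R/𝔭 = 𝔽₂`, `2 ∈ 𝔭 ∖ 𝔭²` ⟹ `ε⁴ − 1 ∉ 𝔭⁶` and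
`ε⁴ + 1 ∉ 𝔭⁶` (in `R_𝔭`, `2` a uniformiser: `ε = ±1 + 8a`, `a` odd; `ε² = 1 + 16d`, `d = ±a + 4a²` odd; `ε⁴ − 1 = 32 d(1 + 8d)` has exact valuation `5`,
`ε⁴ + 1 = 2 + (ε⁴ − 1)` exact valuation `1`). («`t = 3` ⟹ `σ₁(ε⁴) ≡ 33 (mod 64)`.») [cite: Omeara1963, §63A (dyadic unit residues)]
[cite: NeukirchANT1999, Ch. I §11 (localisation at a prime is a DVR)] -/
theorem pow_four_sub_one_not_mem_pow_six (hP0 : P ≠ ⊥) (hres : ∀ r : R, r ∈ P ∨ r - 1 ∈ P) (h2 : (2 : R) ∈ P) (h2' : (2 : R) ∉ P ^ 2)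
    {ε : R} (h3 : ε - 1 ∈ P ^ 3 ∨ ε + 1 ∈ P ^ 3) (hε1 : ε - 1 ∉ P ^ 4) (hε2 : ε + 1 ∉ P ^ 4) :
    ε ^ 4 - 1 ∉ P ^ 6 ∧ ε ^ 4 + 1 ∉ P ^ 6 := by
  classical
  set S := Localization.AtPrime P with hS
  obtain ⟨hdig, -, h2S, hmem, -⟩ := dyadicLocalization_package P S hP0 hres h2 h2'
  have hndvd1 : ∀ y : S, (1 : S) ≠ 2 * y := fun y hy => h2S (isUnit_of_dvd_one ⟨y, hy⟩)
  have h20 : (2 : S) ≠ 0 := by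
    intro h
    apply h2'
    have : (2 : R) = 0 :=
      IsLocalization.injective S P.primeCompl_le_nonZeroDivisors (by rw [map_ofNat, map_zero, h])
    rw [this]
    exact zero_mem _
  have h32ne : (32 : S) ≠ 0 := by rw [show (32 : S) = 2 ^ 5 by norm_num]; exact pow_ne_zero 5 h20
  -- `ε = σ + 8a` with `a` odd
  have key : ∀ σ : R, (σ = 1 ∨ σ = -1) → ε - σ ∈ P ^ 3 → ε - σ ∉ P ^ 4 → ε ^ 4 - 1 ∉ P ^ 6 ∧ ε ^ 4 + 1 ∉ P ^ 6 := by
    intro σ hσ h3σ h4σ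
    obtain ⟨a, ha⟩ := (hmem _ 3).mp h3σ
    obtain ⟨a', ha' | ha'⟩ := hdig a
    · exact absurd ((hmem _ 4).mpr ⟨a', by rw [ha, ha']; ring⟩) h4σ
    have hσ2 : (algebraMap R S σ) ^ 2 = 1 := by
      rcases hσ with rfl | rfl
      · rw [map_one, one_pow]
      · rw [map_neg, map_one, neg_one_sq]
    rw [map_sub] at ha
    have hεS : algebraMap R S ε = algebraMap R S σ + 8 * (1 + 2 * a') := by linear_combination ha + 8 * ha'
    -- `ε⁴ − 1 = 32 c` with `c` odd, `ε⁴ + 1 = 2 (1 + 16 c)`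
    obtain ⟨c, hc, hcodd⟩ : ∃ c : S, algebraMap R S (ε ^ 4 - 1) = 32 * c ∧ ∃ c' : S, c = 1 + 2 * c' := by
      refine ⟨((algebraMap R S σ) * (1 + 2 * a') + 4 * (1 + 2 * a') ^ 2) * (1 + 8 * ((algebraMap R S σ) * (1 + 2 * a') + 4 * (1 + 2 * a') ^ 2)), ?_, ?_⟩
      · rw [map_sub, map_pow, map_one, hεS]
        linear_combination ((algebraMap R S σ) ^ 2 + 1 + 32 * algebraMap R S σ * (1 + 2 * a') + 128 * (1 + 2 * a') ^ 2) * hσ2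
      · rcases hσ with rfl | rfl
        · exact ⟨a' + 2 * (1 + 2 * a') ^ 2 + 4 * ((1 + 2 * a') + 4 * (1 + 2 * a') ^ 2) ^ 2, by rw [map_one]; ring⟩
        · exact ⟨-1 - a' + 2 * (1 + 2 * a') ^ 2 + 4 * (-(1 + 2 * a') + 4 * (1 + 2 * a') ^ 2) ^ 2, by rw [map_neg, map_one]; ring⟩
    obtain ⟨c', hc'⟩ := hcodd
    refine ⟨fun h6 => ?_, fun h6 => ?_⟩
    · obtain ⟨y, hy⟩ := (hmem _ 6).mp h6
      rw [hc, hc'] at hy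
      have h32 : (32 : S) * (1 + 2 * c') = 32 * (2 * y) := by rw [hy]; ring
      have := mul_left_cancel₀ h32ne h32
      exact hndvd1 (y - c') (by linear_combination this)
    · obtain ⟨y, hy⟩ := (hmem _ 6).mp h6
      have h' : algebraMap R S (ε ^ 4 + 1) = 2 + algebraMap R S (ε ^ 4 - 1) := by
        rw [map_add, map_sub, map_pow, map_one]; ring
      rw [h', hc, hc'] at hy
      have h2c : (2 : S) * (1 + 16 * (1 + 2 * c')) = 2 * (32 * y) := by linear_combination hy
      have := mul_left_cancel₀ h20 h2c
      exact hndvd1 (16 * y - 8 * (1 + 2 * c')) (by linear_combination this)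
  rcases h3 with h3 | h3
  · exact key 1 (Or.inl rfl) (by simpa using h3) (by simpa using hε1)
  · exact key (-1) (Or.inr rfl) (by simpa using h3) (by simpa using hε2)

end Residue

section Door

variable {K : Type} [Field K] [NumberField K]

/-- ★★ **A unit of `K_3` whose norm to `K` is `≢ ±1 (mod 𝔭₁⁶)` is NOT a norm from `K_4`** — the displayed unit hypothesis `hnot` of att-p4 g42's quadratic-step
unit door `classicalMuVanishes_two_of_unit_not_mem_norm_layer_succ` at `k = 3` (cell bsd-f1-sign2 customers `N = 1259, 14891`: `η ∈ E_{K_3}` with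
`N_{K_3/K}(η) = −ε⁴`, `ε ≡ 9 (mod 16)` at `𝔭₁`).  `K` of odd degree, `2 ∤ d_K`, `κ` cyclotomic, `𝔭₁` with `𝓞_K/𝔭₁ = 𝔽₂`, `2 ∈ 𝔭₁ ∖ 𝔭₁²`; `η ∈ K_3ˣ`
with `N_{K_3/K}(η) = x ∈ 𝓞_Kˣ`, `x ∓ 1 ∉ 𝔭₁⁶`.  If `η = N_{K_4/K_3}(z)` then `x = N_{K_3/K}(N_{K_4/K_3} z) = N_{K_4/K}(z)` (transitivity), contradicting
`unitsIncl_unitsMap_not_mem_map_norm_layer_four`. [cite: Washington1997, §13.3 (`E_n ∩ N K_{n+1}ˣ`)] [cite: NeukirchANT1999, Ch. I §2 Cor. (2.7) (transitivity)]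
[cite: NeukirchANT1999, Ch. V §1] -/
theorem unitsIncl_layer_three_not_mem_map_norm_layer_four (hK : ¬ 2 ∣ Module.finrank ℚ K) (hd : ¬ (2 : ℤ) ∣ NumberField.discr K)
    (κ : ZpExtension K 2) (hκ : κ.IsCyclotomic) [NumberField (κ.layer 3)] [NumberField (κ.layer (3 + 1))]
    (P : Ideal (𝓞 K)) [P.IsMaximal] (hP0 : P ≠ ⊥) (hres : ∀ r : 𝓞 K, r ∈ P ∨ r - 1 ∈ P)
    (h2 : (2 : 𝓞 K) ∈ P) (h2' : (2 : 𝓞 K) ∉ P ^ 2) (x : (𝓞 K)ˣ) (hx1 : (x : 𝓞 K) - 1 ∉ P ^ 6) (hx2 : (x : 𝓞 K) + 1 ∉ P ^ 6)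
    (η : (κ.layer 3)ˣ) (hη : Algebra.norm K (η : κ.layer 3) = algebraMap (𝓞 K) K x) :
    letI : Algebra (κ.layer 3) (κ.layer (3 + 1)) := (IntermediateField.inclusion (κ.layer_mono (Nat.le_succ 3))).toRingHom.toAlgebra
    unitsIncl (κ.layer 3) (κ.layer (3 + 1)) η ∉
      (⊤ : Subgroup (κ.layer (3 + 1))ˣ).map (Herbrand.norm ((κ.layer (3 + 1)) ≃ₐ[κ.layer 3] (κ.layer (3 + 1)))) := by
  classical
  haveI : Fact (Nat.Prime 2) := ⟨Nat.prime_two⟩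
  have h34 : κ.layer 3 ≤ κ.layer (3 + 1) := κ.layer_mono (Nat.le_succ 3)
  letI alg : Algebra (κ.layer 3) (κ.layer (3 + 1)) := (IntermediateField.inclusion h34).toRingHom.toAlgebra
  haveI tow : IsScalarTower K (κ.layer 3) (κ.layer (3 + 1)) :=
    IsScalarTower.of_algebraMap_eq fun y => ((IntermediateField.inclusion h34).commutes y).symm
  haveI : FiniteDimensional K (κ.layer 3) := κ.finiteDimensional_layer_holds 3
  haveI : FiniteDimensional K (κ.layer (3 + 1)) := κ.finiteDimensional_layer_holds (3 + 1)
  haveI : IsGalois K (κ.layer (3 + 1)) := κ.isGalois_layer_holds (3 + 1)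
  haveI : IsGalois (κ.layer 3) (κ.layer (3 + 1)) := IsGalois.tower_top_of_isGalois K _ _
  haveI : FiniteDimensional (κ.layer 3) (κ.layer (3 + 1)) := Module.Finite.of_restrictScalars_finite K _ _
  haveI : Module.Free (κ.layer 3) (κ.layer (3 + 1)) := Module.Free.of_divisionRing _ _
  show unitsIncl (κ.layer 3) (κ.layer (3 + 1)) η ∉ _
  rintro ⟨zu, -, hzu⟩
  -- `η = N_{K_4/K_3}(z)`
  have hn3 : algebraMap (κ.layer 3) (κ.layer (3 + 1)) (Algebra.norm (κ.layer 3) (zu : κ.layer (3 + 1))) =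
      algebraMap (κ.layer 3) (κ.layer (3 + 1)) (η : κ.layer 3) := by
    rw [Algebra.norm_eq_prod_automorphisms]
    have := congrArg (fun y : (κ.layer (3 + 1))ˣ => (y : κ.layer (3 + 1))) hzu
    simp only [Herbrand.norm_apply, Units.coe_prod, val_smul] at this
    exact this
  have hn3' : Algebra.norm (κ.layer 3) (zu : κ.layer (3 + 1)) = (η : κ.layer 3) := (algebraMap _ _).injective hn3
  -- `x = N_{K_4/K}(z)`
  have hn4 : Algebra.norm K (zu : κ.layer (3 + 1)) = algebraMap (𝓞 K) K x := by
    rw [← Algebra.norm_norm (R := K) (S := κ.layer 3), hn3', hη]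
  apply unitsIncl_unitsMap_not_mem_map_norm_layer_four hK hd κ hκ P hP0 hres h2 h2' x hx1 hx2
  refine ⟨zu, Subgroup.mem_top _, ?_⟩
  apply Units.ext
  have : ((Herbrand.norm ((κ.layer (3 + 1)) ≃ₐ[K] (κ.layer (3 + 1))) zu : (κ.layer (3 + 1))ˣ) : κ.layer (3 + 1)) =
      algebraMap K (κ.layer (3 + 1)) (Algebra.norm K (zu : κ.layer (3 + 1))) := by
    rw [Algebra.norm_eq_prod_automorphisms]
    simp only [Herbrand.norm_apply, Units.coe_prod, val_smul]
  rw [this, hn4]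
  rfl

end Door

end Literature.NumberTheory.IwasawaTheory

end
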